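import Summits.Parity.GeneralizedHardyLittlewood.Theorems.LeeYangFibresCellParityLawInductionDefs
import Summits.Parity.GeneralizedHardyLittlewood.Theorems.LeeYangFibresCellParityLawKernelInductionAux
import Summits.Parity.GeneralizedHardyLittlewood.Theorems.LeeYangFibresCellParityLawKernelInductionStep
import HarnessLib

/-!
# Route `LeeYangFibres`, crux `CellParityLaw` (stmt-Parity-14109), line `section-annihilator`:
# the base `m = 2` of the induction `KernelInduction` (skeleton v19)

`stub_inductionBaseTwo : InductionBaseTwo`, i.e. `PrimeUpperBound → EffectiveWeightedP2Law → CellLawAt 2`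
(`…InductionDefs`): the `2`-cell law with the explicit parity parameter `δ* = cellDelta 𝒜 x z
= max 0 (2 − C₁/T)`,

  `|C₂(𝒜; x, z) − (1 + (δ* − 1)(−1)²) I_2(u') T| ≤ kernelErr C κ A₂ 𝒜 x z η Λ R`,

from the weighted `P₂` law at `j = 1` and the linear-sieve upper bound for the primes of the sequence.

* On a rough pair `q = p p'`, `z < p ≤ p'`, `q ≤ x`, one has `p² ≤ q ≤ x`
  (`VanishAux.minFac_pow_cardFactors_le`), hence `u_p = log(x/p)/log p ≥ 1` and `I_1(u_p) = 1`
  (`roughCellDensity_one_of_one_le`): the weighted pair sum `weightedPairSum 𝒜 x z 1` IS the cell `C₂`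
  (`InductionBaseTwoAux.weightedPairSum_one_eq`).
* `EffectiveWeightedP2Law` at `j = 1`: `|C₂ − I_2(u') (2T − C₁)| ≤ kernelErr C_P κ_P A₂P`.
* Clipping (`StepAux.clip_defect_le`): with `cd := C₁ − (2 − δ*) T`, `2T − C₁ = δ* T − cd` and
  `|cd| ≤ max 0 (C₁ − 2T) ≤ kernelErr C_U κ_U A₂U` by `PrimeUpperBound` (and `kernelErr ≥ 0`).
* `0 ≤ I_2(u') ≤ u' ≤ u + 1` (`roughCellDensity_nonneg/_le`), so
  `|C₂ − δ* I_2(u') T| ≤ kernelErr C_P κ_P A₂P + (u+1) kernelErr C_U κ_U A₂U`, merged into one currency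
  `kernelErr (C_P + (u+1) C_U) (min (min κ_P κ_U) 1) (max A₂P A₂U)` by `KernelErrAux.kernelErr_mono/_smul/_add`.

References: E. Bombieri, RIMS Kôkyûroku 294 (1977) p. 5 [BombieriRIMS1977]; E. Bombieri, Rend. Accad. Naz. XL
(5) 1/2 (1975/76) [BombieriAsymptoticSieve1976].
-/

noncomputable section

open scoped BigOperators Classical
open Finset Literature.NumberTheory.Sieve

namespace Summit.Parity.GeneralizedHardyLittlewood.Cruxes.CellParityLaw.SectionAnnihilator

namespace InductionBaseTwoAux

/-- On a rough pair `q` (`Ω(q) = 2`, `1 ≤ q ≤ x`): `p = P⁻(q)` satisfies `p² ≤ q ≤ x`, so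
`u_p = log(x/p)/log p ≥ 1`. -/
theorem one_le_div_log_minFac {x z : ℝ} {q : ℕ}
    (hq : q ∈ (Finset.Ioc 0 ⌊x⌋₊).filter
      (fun q : ℕ => z < (Nat.minFac q : ℝ) ∧ ArithmeticFunction.cardFactors q = 2)) :
    1 ≤ Real.log (x / (Nat.minFac q : ℝ)) / Real.log (Nat.minFac q : ℝ) := by
  simp only [Finset.mem_filter, Finset.mem_Ioc] at hq
  obtain ⟨⟨hq0, hqx⟩, -, hΩ⟩ := hq
  have hq1 : q ≠ 1 := by
    rintro rfl
    simp [ArithmeticFunction.cardFactors_one] at hΩ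
  have hp : q.minFac.Prime := Nat.minFac_prime hq1
  have hp2 : (2 : ℝ) ≤ q.minFac := by exact_mod_cast hp.two_le
  have hp0 : (0 : ℝ) < q.minFac := by linarith
  have hx1 : (1 : ℝ) ≤ x := Nat.floor_pos.mp (by omega)
  have hqx' : (q : ℝ) ≤ x := (Nat.le_floor_iff (by linarith)).mp hqx
  have hpow := VanishAux.minFac_pow_cardFactors_le q hq0
  rw [hΩ] at hpow
  have hpow' : (q.minFac : ℝ) ^ 2 ≤ (q : ℝ) := by exact_mod_cast hpow
  have hple : (q.minFac : ℝ) ≤ x / q.minFac := by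
    rw [le_div_iff₀ hp0]
    nlinarith [hpow', hqx']
  have hlogp : 0 < Real.log (q.minFac : ℝ) := Real.log_pos (by linarith)
  rw [le_div_iff₀ hlogp, one_mul]
  exact Real.log_le_log hp0 hple

/-- **`I_1 ≡ 1` on the rough pairs**: `weightedPairSum 𝒜 x z 1 = C₂(𝒜; x, z)` (no hypothesis on the data). -/
theorem weightedPairSum_one_eq (𝒜 : SieveSequence) (x z : ℝ) :
    weightedPairSum 𝒜 x z 1 = roughCellSum 𝒜 x z 2 := by
  unfold weightedPairSum roughCellSum
  refine Finset.sum_congr rfl fun q hq => ?_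
  rw [roughCellDensity_one_of_one_le (one_le_div_log_minFac hq), mul_one]

/-- `KernelRanges x η Λ w₀ η₀` is monotone in `η₀`. -/
theorem kernelRanges_mono {x η Λ w₀ η₀ η₀' : ℝ} (h : KernelRanges x η Λ w₀ η₀) (hη : η₀ ≤ η₀') :
    KernelRanges x η Λ w₀ η₀' := by
  obtain ⟨h1, h2, h3, h4, h5, h6⟩ := h
  exact ⟨h1, h2.trans hη, h3, h4, h5, h6⟩

/-- **The algebra of the base `m = 2`.** If `|S − I (2T − C₁)| ≤ E_P`, `C₁ ≤ 2T + E_U`, `0 ≤ E_U`,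
`0 ≤ I ≤ B`, `C₁, T ≥ 0` and `T = 0 → C₁ = 0`, then with `δ* = max 0 (2 − C₁/T)`:
`|S − (1 + (δ* − 1)(−1)²) I T| ≤ E_P + B E_U` (`2T − C₁ = δ* T − cd`, `|cd| ≤ max 0 (C₁ − 2T) ≤ E_U` by
`StepAux.clip_defect_le`). -/
theorem base_two_bound {S I T C₁ EP EU B : ℝ} (hS : |S - I * (2 * T - C₁)| ≤ EP)
    (hU : C₁ ≤ 2 * T + EU) (hEU : 0 ≤ EU) (hI0 : 0 ≤ I) (hIB : I ≤ B) (hC : 0 ≤ C₁) (hT : 0 ≤ T)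
    (hTC : T = 0 → C₁ = 0) :
    |S - (1 + (max 0 (2 - C₁ / T) - 1) * (-1 : ℝ) ^ 2) * I * T| ≤ EP + B * EU := by
  obtain ⟨-, -, hcd⟩ := StepAux.clip_defect_le hC hT hTC
  set δ := max 0 (2 - C₁ / T) with hδ
  have hmax : max 0 (C₁ - 2 * T) ≤ EU := max_le hEU (by linarith)
  have hcdE : |C₁ - (2 - δ) * T| ≤ EU := hcd.trans hmax
  have e : S - (1 + (δ - 1) * (-1 : ℝ) ^ 2) * I * T =
      (S - I * (2 * T - C₁)) - I * (C₁ - (2 - δ) * T) := by ring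
  rw [e]
  calc |S - I * (2 * T - C₁) - I * (C₁ - (2 - δ) * T)|
      ≤ |S - I * (2 * T - C₁)| + |I * (C₁ - (2 - δ) * T)| := abs_sub _ _
    _ ≤ EP + B * EU := by
        rw [abs_mul, abs_of_nonneg hI0]
        have : I * |C₁ - (2 - δ) * T| ≤ B * EU := mul_le_mul hIB hcdE (abs_nonneg _) (hI0.trans hIB)
        linarith

end InductionBaseTwoAux

open InductionBaseTwoAux in
/-- **`stub_inductionBaseTwo`** (registered sub-goal of `stub_kernelInduction`, skeleton v19, line
`section-annihilator`): the base `m = 2` of the induction, `PrimeUpperBound → EffectiveWeightedP2Law → CellLawAt 2`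
— the weighted `P₂` law at `j = 1` (where the weighted pair sum is the cell `C₂` itself) plus the clipping of
the parity parameter against the linear-sieve upper bound; constants `κ := min (min κ_P κ_U) 1`,
`C := C_P + (u+1) C_U`, `η₀ := min (min η₀P η₀U) 1`, `A₂ := max A₂P A₂U`,
`x₀ := max (max x₀P x₀U) (exp (2(u+1)))`. -/
theorem stub_inductionBaseTwo : InductionBaseTwo := by
  intro hPUB hP2 u A₁ L' hu
  obtain ⟨κU, CU, η₀U, A₂U, x₀U, hκU, hCU, hη₀U, hU⟩ := hPUB u A₁ L' hu
  obtain ⟨κP, CP, η₀P, A₂P, x₀P, hκP, hCP, hη₀P, hP⟩ := hP2 u A₁ L' hu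
  have hu2 : (2 : ℝ) ≤ u := by exact_mod_cast hu
  have hu10 : (0 : ℝ) < (u : ℝ) + 1 := by linarith
  -- the constants
  set κ : ℝ := min (min κP κU) 1 with hκ
  have hκ0 : 0 < κ := lt_min (lt_min hκP hκU) one_pos
  have hκ1 : κ ≤ 1 := min_le_right _ _
  have hκP' : κ ≤ κP := (min_le_left _ _).trans (min_le_left _ _)
  have hκU' : κ ≤ κU := (min_le_left _ _).trans (min_le_right _ _)
  set η₀ : ℝ := min (min η₀P η₀U) 1 with hη₀
  have hη₀0 : 0 < η₀ := lt_min (lt_min hη₀P hη₀U) one_pos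
  set A₂ : ℕ := max A₂P A₂U with hA₂
  set x₀ : ℝ := max (max x₀P x₀U) (Real.exp (2 * ((u : ℝ) + 1))) with hx₀
  have hC0 : 0 ≤ CP + ((u : ℝ) + 1) * CU := add_nonneg hCP (mul_nonneg hu10.le hCU)
  refine ⟨κ, CP + ((u : ℝ) + 1) * CU, η₀, A₂, x₀, hκ0, hκ1, hC0, hη₀0, ?_⟩
  intro 𝒜 x z η Λ w₀ R hxx₀ hzlo hzhi hKR hKA
  -- the two hypotheses at these data
  have hx₀P : x₀P ≤ x := le_trans (le_trans (le_max_left _ _) (le_max_left _ _)) hxx₀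
  have hx₀U : x₀U ≤ x := le_trans (le_trans (le_max_right _ _) (le_max_left _ _)) hxx₀
  have hxe : Real.exp (2 * ((u : ℝ) + 1)) ≤ x := le_trans (le_max_right _ _) hxx₀
  have hKRP : KernelRanges x η Λ w₀ η₀P :=
    kernelRanges_mono hKR ((min_le_left _ _).trans (min_le_left _ _))
  have hKRU : KernelRanges x η Λ w₀ η₀U :=
    kernelRanges_mono hKR ((min_le_left _ _).trans (min_le_right _ _))
  have hPx := hP 𝒜 x z η Λ w₀ R hx₀P hzlo hzhi hKRP hKA 1 le_rfl
  have hUx := hU 𝒜 x z η Λ w₀ R hx₀U hzlo hzhi hKRU hKA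
  obtain ⟨hηlo, hηhi, hΛ1, -, -, -⟩ := hKR
  obtain ⟨-, -, -, hsize, -, hdim, -, hTypeI⟩ := hKA
  rw [StrongTypeI] at hTypeI
  /- 1. data facts: ranges of `x`, `z`, `u'`, `η`, `Λ` -/
  have hx0 : 0 < x := (Real.exp_pos _).trans_le hxe
  have hlx : 2 * ((u : ℝ) + 1) ≤ Real.log x := by
    rw [← Real.log_exp (2 * ((u : ℝ) + 1))]
    exact Real.log_le_log (Real.exp_pos _) hxe
  have hlx0 : 0 < Real.log x := by linarith
  have hx1 : Real.exp 1 ≤ x := by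
    rw [← Real.le_log_iff_exp_le hx0]
    linarith
  have he1 : 1 < Real.exp 1 := Real.one_lt_exp_iff.mpr one_pos
  have hx1' : 1 ≤ x := he1.le.trans hx1
  have hz0 : 0 < z := (Real.rpow_pos_of_pos hx0 _).trans_le hzlo
  have hlzlo : Real.log x / ((u : ℝ) + 1) ≤ Real.log z := by
    have h := Real.log_le_log (Real.rpow_pos_of_pos hx0 _) hzlo
    rw [Real.log_rpow hx0] at h
    calc Real.log x / ((u : ℝ) + 1) = 1 / ((u : ℝ) + 1) * Real.log x := by ring
      _ ≤ Real.log z := h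
  have hlzhi : Real.log z ≤ Real.log x / 2 := by
    have h := Real.log_le_log hz0 hzhi
    rw [Real.log_rpow hx0] at h
    linarith
  have hlz2 : 2 ≤ Real.log z := by
    refine le_trans ?_ hlzlo
    rw [le_div_iff₀ hu10]
    linarith
  have hlz0 : 0 < Real.log z := by linarith
  have hz1 : Real.exp 1 ≤ z := by
    rw [← Real.le_log_iff_exp_le hz0]
    linarith
  have hz1' : 1 < z := he1.trans_le hz1
  set u' : ℝ := Real.log x / Real.log z with hu'
  have hu'1 : 1 ≤ u' := by
    rw [hu', le_div_iff₀ hlz0]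
    linarith
  have hu'le : u' ≤ (u : ℝ) + 1 := by
    rw [hu', div_le_iff₀ hlz0]
    rw [div_le_iff₀ hu10] at hlzlo
    linarith
  have hu'0 : 0 < u' := by linarith
  have hη0 : 0 < η := (Real.rpow_pos_of_pos hlx0 _).trans_le hηlo
  have hη1 : η ≤ 1 := hηhi.trans (min_le_right _ _)
  have hΛ : (1 : ℝ) / 2 ≤ Λ := by linarith
  /- 2. data facts: `V > 0`, `A ≥ 0`, `R ≥ 0`, `T ≥ 0`, `T = 0 → C₁ = 0` -/
  have hV0 : 0 < 𝒜.densityProduct (primesProdBelow z) := hdim.densityProduct_pos z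
  have hC₁ := StepAux.roughCellSum_le_size 𝒜 x z 1 hsize
  have hA0 : 0 ≤ 𝒜.size x := hC₁.1.trans hC₁.2
  have hR0 : 0 ≤ R :=
    le_trans (Finset.sum_nonneg fun _ _ => abs_nonneg _) (hTypeI (fun _ => x) fun _ => le_rfl)
  set T : ℝ := primeMain 𝒜 x z with hT
  have hG0 : 0 < Real.exp Real.eulerMascheroniConstant := Real.exp_pos _
  have hTeq : T = Real.exp Real.eulerMascheroniConstant * 𝒜.densityProduct (primesProdBelow z) *
      𝒜.size x / u' := by
    rw [hT, hu', primeMain]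
  have hT0 : 0 ≤ T := by
    rw [hTeq]
    exact div_nonneg (mul_nonneg (mul_nonneg hG0.le hV0.le) hA0) hu'0.le
  have hTC : T = 0 → roughCellSum 𝒜 x z 1 = 0 := by
    intro h0
    rw [hTeq, div_eq_zero_iff] at h0
    have h1 := h0.resolve_right hu'0.ne'
    have hA : 𝒜.size x = 0 := (mul_eq_zero.mp h1).resolve_left (mul_pos hG0 hV0).ne'
    linarith [hC₁.1, hC₁.2]
  /- 3. the estimate -/
  have hI0 : 0 ≤ roughCellDensity 2 u' := roughCellDensity_nonneg 2 u'
  have hIB : roughCellDensity 2 u' ≤ (u : ℝ) + 1 := (roughCellDensity_le (by norm_num) hu'1).trans hu'le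
  rw [weightedPairSum_one_eq] at hPx
  have hS : |roughCellSum 𝒜 x z 2 - roughCellDensity 2 u' * (2 * T - roughCellSum 𝒜 x z 1)| ≤
      kernelErr CP κP A₂P 𝒜 x z η Λ R := hPx
  have hEU0 : 0 ≤ kernelErr CU κU A₂U 𝒜 x z η Λ R :=
    KernelErrAux.kernelErr_nonneg hCU hη0.le hΛ hz1' hx1' hV0.le hA0 hR0
  have key : |roughCellSum 𝒜 x z 2 -
      (1 + (cellDelta 𝒜 x z - 1) * (-1 : ℝ) ^ 2) * roughCellDensity 2 u' * T| ≤
      kernelErr CP κP A₂P 𝒜 x z η Λ R + ((u : ℝ) + 1) * kernelErr CU κU A₂U 𝒜 x z η Λ R :=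
    base_two_bound hS hUx hEU0 hI0 hIB hC₁.1 hT0 hTC
  calc |roughCellSum 𝒜 x z 2 - (1 + (cellDelta 𝒜 x z - 1) * (-1 : ℝ) ^ 2) * roughCellDensity 2 u' * T|
      ≤ kernelErr CP κP A₂P 𝒜 x z η Λ R + ((u : ℝ) + 1) * kernelErr CU κU A₂U 𝒜 x z η Λ R := key
    _ ≤ kernelErr CP κ A₂ 𝒜 x z η Λ R + kernelErr (((u : ℝ) + 1) * CU) κ A₂ 𝒜 x z η Λ R := by
        rw [KernelErrAux.kernelErr_smul]
        exact add_le_add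
          (KernelErrAux.kernelErr_mono hCP le_rfl hκ0 hκP' (le_max_left _ _) hη0.le hη1 hΛ hz1 hx1
            hV0.le hA0 hR0)
          (KernelErrAux.kernelErr_mono (mul_nonneg hu10.le hCU) le_rfl hκ0 hκU' (le_max_right _ _)
            hη0.le hη1 hΛ hz1 hx1 hV0.le hA0 hR0)
    _ = kernelErr (CP + ((u : ℝ) + 1) * CU) κ A₂ 𝒜 x z η Λ R := KernelErrAux.kernelErr_add _ _ _ _ _ _ _ _ _ _

end Summit.Parity.GeneralizedHardyLittlewood.Cruxes.CellParityLaw.SectionAnnihilator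

end
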